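import Summits.AtomisticToContinuum.HydrodynamicLimit.Theorems.AntiMazurCoboundariesFejerDefectIdentity
import Literature.Analysis.FluidPDE.LocalForecastCorrector

/-!
# Tools for the local-certificate transfer skeleton

Route `AntiMazurCoboundaries` of `AtomisticToContinuum/HydrodynamicLimit`, support item
stmt-AtomisticToContinuum-13917 (`LocalCertificateTransfer`). Helper lemmas (`--supports`) used by the transfer
skeleton `AntiMazurCoboundariesTransferSkeleton`:

* `TransferSkeleton.exp_add_three_le` — AM–GM for three exponentials (the measurability-free substitute
  for Hölder in three groups, plan step (4));
* `TransferSkeleton.intervalIntegral_weight_mul_sum`, `TransferSkeleton.intervalIntegral_sum` — swapping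
  the particle sum with (weighted) time integrals along a measurable orbit;
* `TransferSkeleton.abs_window_true_sub_forecast_le` — the true window average and the forecast window
  average differ by at most `2C` per BAD particle (the event of `InfluenceLocality`);
* `TransferSkeleton.measurable_forecastWindow`, `TransferSkeleton.aemeasurable_shotNoise`,
  `TransferSkeleton.measurable_uncurry_primitive_flowMod`, `TransferSkeleton.aemeasurable_lagAverageWindow`
  — measurability of the forecast window average, and a.e.-measurability (under laws not charging the bad
  data) of the within-lag shot noise and of the lag-average of window averages, via the jointly measurable
  modified flow `flowMod`;
* `TransferSkeleton.ofReal_third_mul_three`, `TransferSkeleton.ofReal_half_mul_two` — arithmetic in `ℝ≥0∞`.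

References: route docstring of stmt-AtomisticToContinuum-13917; folklore.
-/

noncomputable section

open MeasureTheory Set Filter Topology

namespace Summit.AtomisticToContinuum.HydrodynamicLimit.Theorems

open Literature.Analysis.FluidPDE
open Literature.MathematicalPhysics.KineticTheory (T3 V3)


namespace TransferSkeleton

open BoltzmannGreenKuboOrthMomentum (flowMod flowMod_of_mem measurable_flowMod)

variable {N : ℕ} {ε : ℝ}

/-- AM–GM for three exponentials: `exp(x + y + z) ≤ (exp 3x + exp 3y + exp 3z)/3`. [folklore] -/
theorem exp_add_three_le (x y z : ℝ) :
    Real.exp (x + y + z) ≤ (Real.exp (3 * x) + Real.exp (3 * y) + Real.exp (3 * z)) / 3 := by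
  have key : ∀ a b c : ℝ, 0 ≤ a → 0 ≤ b → 0 ≤ c → a * b * c ≤ (a ^ 3 + b ^ 3 + c ^ 3) / 3 := by
    intro a b c ha hb hc
    nlinarith [sq_nonneg (a - b), sq_nonneg (b - c), sq_nonneg (a - c), mul_nonneg ha hb,
      mul_nonneg hb hc, mul_nonneg ha hc, mul_nonneg (mul_nonneg ha hb) hc]
  have h := key (Real.exp x) (Real.exp y) (Real.exp z) (Real.exp_pos _).le (Real.exp_pos _).le
    (Real.exp_pos _).le
  rw [← Real.exp_add, ← Real.exp_add] at h
  have e3 : ∀ w : ℝ, Real.exp w ^ 3 = Real.exp (3 * w) := fun w => by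
    rw [← Real.exp_nat_mul]; norm_num
  rw [e3, e3, e3] at h
  exact h

/-- Swap of a finite sum of one-body terms with a weighted time integral along a measurable orbit.
[folklore] -/
theorem intervalIntegral_weight_mul_sum (γ : ℝ → Config N (Fin 3) T3) (hγ : Measurable γ)
    {f : T3 × EuclideanSpace ℝ (Fin 3) → ℝ} (hfm : Measurable f) {C : ℝ} (hf : ∀ q, |f q| ≤ C)
    {w : ℝ → ℝ} (hw : Continuous w) (a b : ℝ) :
    ∫ t in a..b, w t * ∑ i, f (γ t i) = ∑ i, ∫ t in a..b, w t * f (γ t i) := by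
  have hI : ∀ i, IntervalIntegrable (fun t => w t * f (γ t i)) volume a b := by
    intro i
    have h1 : IntervalIntegrable (fun t => f (γ t i)) volume a b :=
      FejerDefect.intervalIntegrable_of_abs_le (hfm.comp ((measurable_pi_apply i).comp hγ))
        (fun t => hf _) a b
    exact h1.continuousOn_mul hw.continuousOn
  rw [← intervalIntegral.integral_finsetSum fun i _ => hI i]
  refine intervalIntegral.integral_congr fun t _ => ?_
  simp only [Finset.mul_sum]

open scoped Classical in
/-- **The true window average differs from the forecast window average only on bad particles**: with
`|f| ≤ C` and `0 < H`, `|Σᵢ H⁻¹∫₀ᴴ f((Φ_t z)ᵢ) dt − Σᵢ H⁻¹∫₀ᴴ f(ζ^{(i,R)}_t(z)) dt| ≤ 2C · #bad(z)` for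
any flow map. [folklore] -/
theorem abs_window_true_sub_forecast_le (Ψ : (k : ℕ) → HardSphereFlow (Torus.geometry (Fin 3)) ε k)
    (flow : ℝ → Config N (Fin 3) T3 → Config N (Fin 3) T3) (R : ℝ) {H : ℝ} (hH : 0 < H)
    {f : T3 × EuclideanSpace ℝ (Fin 3) → ℝ} {C : ℝ} (hf : ∀ q, |f q| ≤ C) (z : Config N (Fin 3) T3) :
    |(∑ i, H⁻¹ * ∫ t in (0 : ℝ)..H, f (flow t z i)) -
        ∑ i, H⁻¹ * ∫ t in (0 : ℝ)..H, f (localClusterState Ψ R t z i)| ≤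
      2 * C * ((Finset.univ.filter fun i : Fin N =>
        ∃ t ∈ Set.Icc (0 : ℝ) H, flow t z i ≠ localClusterState Ψ R t z i).card : ℝ) := by
  classical
  set bad : Finset (Fin N) := Finset.univ.filter fun i : Fin N =>
    ∃ t ∈ Set.Icc (0 : ℝ) H, flow t z i ≠ localClusterState Ψ R t z i with hbad
  set dᵢ : Fin N → ℝ := fun i =>
    (H⁻¹ * ∫ t in (0 : ℝ)..H, f (flow t z i)) - H⁻¹ * ∫ t in (0 : ℝ)..H, f (localClusterState Ψ R t z i)
    with hd
  have hsum : (∑ i, H⁻¹ * ∫ t in (0 : ℝ)..H, f (flow t z i)) -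
      ∑ i, H⁻¹ * ∫ t in (0 : ℝ)..H, f (localClusterState Ψ R t z i) = ∑ i, dᵢ i := by
    rw [← Finset.sum_sub_distrib]
  have hgood : ∀ i, i ∉ bad → dᵢ i = 0 := by
    intro i hi
    have hall : ∀ t ∈ Set.Icc (0 : ℝ) H, flow t z i = localClusterState Ψ R t z i := by
      intro t ht
      by_contra hne
      exact hi (Finset.mem_filter.2 ⟨Finset.mem_univ _, t, ht, hne⟩)
    have hint : ∫ t in (0 : ℝ)..H, f (flow t z i) = ∫ t in (0 : ℝ)..H, f (localClusterState Ψ R t z i) := by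
      refine intervalIntegral.integral_congr fun t ht => ?_
      rw [uIcc_of_le hH.le] at ht
      simp only [hall t ht]
    simp only [hd, hint, _root_.sub_self]
  have hwin : ∀ φ' : ℝ → ℝ, (∀ t, |φ' t| ≤ C) → |H⁻¹ * ∫ t in (0 : ℝ)..H, φ' t| ≤ C := by
    intro φ' hφ'
    have hb : ‖∫ t in (0 : ℝ)..H, φ' t‖ ≤ C * |H - 0| :=
      intervalIntegral.norm_integral_le_of_norm_le_const fun t _ => by
        rw [Real.norm_eq_abs]
        exact hφ' _
    rw [Real.norm_eq_abs, sub_zero, abs_of_pos hH] at hb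
    rw [abs_mul, abs_inv, abs_of_pos hH]
    calc H⁻¹ * |∫ t in (0 : ℝ)..H, φ' t| ≤ H⁻¹ * (C * H) := by gcongr
      _ = C := by field_simp
  have hbadle : ∀ i, |dᵢ i| ≤ 2 * C := by
    intro i
    calc |dᵢ i| ≤ |H⁻¹ * ∫ t in (0 : ℝ)..H, f (flow t z i)| +
          |H⁻¹ * ∫ t in (0 : ℝ)..H, f (localClusterState Ψ R t z i)| := abs_sub _ _
      _ ≤ C + C := add_le_add (hwin _ fun t => hf _) (hwin _ fun t => hf _)
      _ = 2 * C := by ring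
  rw [hsum]
  calc |∑ i, dᵢ i| ≤ ∑ i, |dᵢ i| := Finset.abs_sum_le_sum_abs _ _
    _ = ∑ i, if i ∈ bad then |dᵢ i| else 0 := by
        refine Finset.sum_congr rfl fun i _ => ?_
        split_ifs with hi
        · rfl
        · rw [hgood i hi, abs_zero]
    _ = ∑ i ∈ bad, |dᵢ i| := by
        rw [← Finset.sum_filter]
        congr 1
        ext i
        simp
    _ ≤ ∑ _i ∈ bad, 2 * C := Finset.sum_le_sum fun i _ => hbadle i
    _ = 2 * C * (bad.card : ℝ) := by
        rw [Finset.sum_const, nsmul_eq_mul]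
        ring

/-- **Measurability of the forecast window average** `z ↦ Σᵢ H⁻¹∫₀ᴴ f(ζ^{(i,R)}_t(z)) dt`. [folklore] -/
theorem measurable_forecastWindow (Ψ : (k : ℕ) → HardSphereFlow (Torus.geometry (Fin 3)) ε k)
    (R H : ℝ) {f : T3 × EuclideanSpace ℝ (Fin 3) → ℝ} (hfm : Measurable f) :
    Measurable fun z : Config N (Fin 3) T3 =>
      ∑ i, H⁻¹ * ∫ t in (0 : ℝ)..H, f (localClusterState Ψ R t z i) := by
  refine Finset.measurable_sum _ fun i _ => Measurable.const_mul ?_ _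
  have hI : Measurable (Function.uncurry fun (t : ℝ) (z : Config N (Fin 3) T3) =>
      f (localClusterState Ψ R t z i)) :=
    hfm.comp (measurable_localClusterState Ψ Torus.continuous_geometry_translate
      Torus.measurable_geometry_sepVec R i)
  have h : ∀ μ : Measure ℝ, SFinite μ → Measurable fun z : Config N (Fin 3) T3 =>
      ∫ t, f (localClusterState Ψ R t z i) ∂μ := fun μ _ =>
    (hI.stronglyMeasurable.integral_prod_left (μ := μ)).measurable
  simp only [intervalIntegral]
  exact (h _ inferInstance).sub (h _ inferInstance)

/-- **A.e.-measurability of the within-lag shot noise** `F − s⁻¹∫₀ˢ F∘Φ_u` under a law not charging the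
bad data (on the good set it agrees with its modified-flow version). [folklore] -/
theorem aemeasurable_shotNoise (Φ : HardSphereFlow (Torus.geometry (Fin 3)) ε N)
    {F : Config N (Fin 3) T3 → ℝ} (hF : Measurable F) (s : ℝ)
    (μ : Measure (Config N (Fin 3) T3)) (hgood : μ Φ.goodᶜ = 0) :
    AEMeasurable (fun z => F z - s⁻¹ * ∫ u in (0 : ℝ)..s, F (Φ.flow u z)) μ := by
  refine ⟨fun z => F z - s⁻¹ * ∫ u in (0 : ℝ)..s, F (flowMod Φ (u, z)),
    hF.sub ((FejerDefect.measurable_intervalIntegral_flowMod Φ hF 0 s).const_mul _), ?_⟩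
  filter_upwards [(mem_ae_iff.2 hgood : ∀ᵐ z ∂μ, z ∈ Φ.good)] with z hz
  simp only [flowMod_of_mem Φ hz]

/-- **Joint measurability of the primitive along the modified flow**:
`(r, z) ↦ ∫₀ʳ F(flowMod(t, z)) dt` is jointly measurable (continuous in `r`, measurable in `z`).
[folklore] -/
theorem measurable_uncurry_primitive_flowMod (Φ : HardSphereFlow (Torus.geometry (Fin 3)) ε N)
    {F : Config N (Fin 3) T3 → ℝ} (hF : Measurable F) {C : ℝ} (hC : ∀ z, |F z| ≤ C) :
    Measurable (Function.uncurry fun (r : ℝ) (z : Config N (Fin 3) T3) =>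
      ∫ t in (0 : ℝ)..r, F (flowMod Φ (t, z))) := by
  refine measurable_uncurry_of_continuous_of_measurable (fun z => ?_) fun r =>
    FejerDefect.measurable_intervalIntegral_flowMod Φ hF 0 r
  have hsec : Measurable fun t : ℝ => F (flowMod Φ (t, z)) :=
    hF.comp ((measurable_flowMod Φ).comp (measurable_id.prodMk measurable_const))
  exact intervalIntegral.continuous_primitive
    (FejerDefect.intervalIntegrable_of_abs_le hsec (fun t => hC _)) 0

/-- **A.e.-measurability of the lag-average of window averages**
`z ↦ s⁻¹∫₀ˢ H⁻¹∫_u^{u+H} F(Φ_t z) dt du` under a law not charging the bad data. [folklore] -/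
theorem aemeasurable_lagAverageWindow (Φ : HardSphereFlow (Torus.geometry (Fin 3)) ε N)
    {F : Config N (Fin 3) T3 → ℝ} (hF : Measurable F) {C : ℝ} (hC : ∀ z, |F z| ≤ C) (s H : ℝ)
    (μ : Measure (Config N (Fin 3) T3)) (hgood : μ Φ.goodᶜ = 0) :
    AEMeasurable (fun z => s⁻¹ * ∫ u in (0 : ℝ)..s, H⁻¹ * ∫ t in u..(u + H), F (Φ.flow t z)) μ := by
  -- measurable model: primitive differences along the modified flow
  set P : ℝ → Config N (Fin 3) T3 → ℝ := fun r z => ∫ t in (0 : ℝ)..r, F (flowMod Φ (t, z)) with hP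
  have hPm : Measurable (Function.uncurry P) := measurable_uncurry_primitive_flowMod Φ hF hC
  have hh : Measurable (Function.uncurry fun (u : ℝ) (z : Config N (Fin 3) T3) =>
      H⁻¹ * (P (u + H) z - P u z)) := by
    have h1 : Measurable fun p : ℝ × Config N (Fin 3) T3 => P (p.1 + H) p.2 :=
      hPm.comp ((measurable_fst.add_const H).prodMk measurable_snd)
    have h2 : Measurable fun p : ℝ × Config N (Fin 3) T3 => P p.1 p.2 := hPm
    exact (h1.sub h2).const_mul _
  have hmodel : Measurable fun z : Config N (Fin 3) T3 =>
      s⁻¹ * ∫ u in (0 : ℝ)..s, H⁻¹ * (P (u + H) z - P u z) := by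
    have h : ∀ ν : Measure ℝ, SFinite ν → Measurable fun z : Config N (Fin 3) T3 =>
        ∫ u, H⁻¹ * (P (u + H) z - P u z) ∂ν := fun ν _ =>
      (hh.stronglyMeasurable.integral_prod_left (μ := ν)).measurable
    simp only [intervalIntegral]
    exact ((h _ inferInstance).sub (h _ inferInstance)).const_mul _
  refine ⟨_, hmodel, ?_⟩
  filter_upwards [(mem_ae_iff.2 hgood : ∀ᵐ z ∂μ, z ∈ Φ.good)] with z hz
  have hsec : Measurable fun t : ℝ => F (flowMod Φ (t, z)) :=
    hF.comp ((measurable_flowMod Φ).comp (measurable_id.prodMk measurable_const))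
  have hint : ∀ a b, IntervalIntegrable (fun t => F (flowMod Φ (t, z))) volume a b :=
    FejerDefect.intervalIntegrable_of_abs_le hsec (fun t => hC _)
  congr 1
  refine intervalIntegral.integral_congr fun u _ => ?_
  simp only [hP]
  rw [intervalIntegral.integral_interval_sub_left (hint 0 (u + H)) (hint 0 u)]
  congr 1
  exact intervalIntegral.integral_congr fun t _ => by simp only [flowMod_of_mem Φ hz]


/-- Unweighted swap: `∫ₐᵇ Σᵢ f(γ(t)ᵢ) dt = Σᵢ ∫ₐᵇ f(γ(t)ᵢ) dt` along a measurable orbit. [folklore] -/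
theorem intervalIntegral_sum (γ : ℝ → Config N (Fin 3) T3) (hγ : Measurable γ)
    {f : T3 × EuclideanSpace ℝ (Fin 3) → ℝ} (hfm : Measurable f) {C : ℝ} (hf : ∀ q, |f q| ≤ C)
    (a b : ℝ) :
    ∫ t in a..b, ∑ i, f (γ t i) = ∑ i, ∫ t in a..b, f (γ t i) := by
  have h := intervalIntegral_weight_mul_sum γ hγ hfm hf continuous_const (w := fun _ => (1 : ℝ)) a b
  simpa only [one_mul] using h

/-- `ENNReal.ofReal 3⁻¹ · (c + c + c) = c`. [folklore] -/
theorem ofReal_third_mul_three (c : ENNReal) : ENNReal.ofReal 3⁻¹ * (c + c + c) = c := by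
  have h3 : ENNReal.ofReal 3⁻¹ * 3 = 1 := by
    rw [← ENNReal.ofReal_ofNat 3, ← ENNReal.ofReal_mul (by norm_num)]
    norm_num
  rw [show c + c + c = 3 * c by ring, ← mul_assoc, h3, one_mul]

/-- `ENNReal.ofReal 2⁻¹ · (c + c) = c`. [folklore] -/
theorem ofReal_half_mul_two (c : ENNReal) : ENNReal.ofReal 2⁻¹ * (c + c) = c := by
  have h2 : ENNReal.ofReal 2⁻¹ * 2 = 1 := by
    rw [← ENNReal.ofReal_ofNat 2, ← ENNReal.ofReal_mul (by norm_num)]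
    norm_num
  rw [show c + c = 2 * c by ring, ← mul_assoc, h2, one_mul]

end TransferSkeleton

end Summit.AtomisticToContinuum.HydrodynamicLimit.Theorems

end
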